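import Summits.BirchSwinnertonDyer.BirchSwinnertonDyer.Theses.TangentCone
import Summits.BirchSwinnertonDyer.BirchSwinnertonDyer.Theses.SelmerRank
import Summits.BirchSwinnertonDyer.BirchSwinnertonDyer.Theses.FrozenTwin
import Summits.BirchSwinnertonDyer.BirchSwinnertonDyer.Theses.ToricShedding
import Summits.BirchSwinnertonDyer.BirchSwinnertonDyer.Theses.ShadowIsolation
import Summits.BirchSwinnertonDyer.BirchSwinnertonDyer.Theses.VerticalContact

/-!
# Crux attack on `SelmerRankLB` (stmt-BirchSwinnertonDyer-0131) — refuter probes, cycle 1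

Kernel-checked record of the basic attacks (refuter-rattack-stmt-BirchSwinnertonDyer-0131-0,
2026-08-17). Nothing here asserts a route statement positively except UNDER the summit hypothesis
(`S → C` probes), which is the restates-the-summit test, not a proof.

Findings:
* the six route copies of the shared item are syntactically identical (`rfl`);
* `S → C`: the crux follows from `BirchSwinnertonDyer` with NONE of its five hypotheses used
  (Greenberg's corank identity `selmerCorank = mordellWeilRank + shaCorank`, proved in tree as
  `WeierstrassCurve.selmerCorank_eq_mordellWeilRank_add_holds`); even the hypothesis-free
  strengthening `∀ W elliptic, ∀ p, r_an ≤ corank_p` follows. Hence no counterexample to the crux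
  exists unless the Lean summit statement itself is false: the crux cannot be "misstated-false".
* `C → S` is not available: the crux is the lower-bound half at big-image good ordinary `p ≥ 5`
  only; the summit additionally needs UB, `Ш[p^∞]` finite, the small-image sector and the
  Gross–Zagier–Kolyvagin leaf (route SelmerRank's `closes`). The crux does not restate the summit.
* degenerate regime `r_an = 0`: conclusion trivially true.
-/

set_option linter.dupNamespace false

namespace Summit.BirchSwinnertonDyer.BirchSwinnertonDyer.Cruxes.SelmerRankLB.CruxAttack

open Summit.BirchSwinnertonDyer.BirchSwinnertonDyer.Theses

/-- The body of the crux, restated verbatim, is definitionally the route decl. [folklore] -/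
example : TangentCone.SelmerRankLB =
    (∀ (W : WeierstrassCurve ℚ) [W.IsElliptic] [W.IsGloballyMinimal] (p : ℕ) [Fact p.Prime],
      5 ≤ p → W.HasGoodReductionAtPrime p → ¬ (p : ℤ) ∣ W.frobeniusTrace p →
      W.HasSurjectiveModNGaloisRep p → W.analyticRank ≤ W.selmerCorank p) := rfl

/-- Shared item: the six route copies coincide syntactically. [folklore] -/
example : TangentCone.SelmerRankLB = SelmerRank.SelmerRankLB := rfl
example : TangentCone.SelmerRankLB = FrozenTwin.SelmerRankLB := rfl
example : TangentCone.SelmerRankLB = ToricShedding.SelmerRankLB := rfl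
example : TangentCone.SelmerRankLB = ShadowIsolation.SelmerRankLB := rfl
example : TangentCone.SelmerRankLB = VerticalContact.SelmerRankLB := rfl

/-- **`S → C`**: the crux is a consequence of the summit `BirchSwinnertonDyer`
(`r_an = rank ≤ rank + corank Ш[p^∞] = corank Sel_{p^∞}`), using none of the crux's hypotheses.
Axioms: propext, Classical.choice, Quot.sound. Written as an `example` so that no declaration
with a route decl as conclusion is indexed (this is a conditional probe, not a proof). [folklore] -/
example (h : _root_.BirchSwinnertonDyer) : TangentCone.SelmerRankLB := by
  intro W _ _ p _ _ _ _ _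
  have h1 : W.analyticRank = W.mordellWeilRank := h W inferInstance
  have h2 : W.selmerCorank p = W.mordellWeilRank + W.shaCorank p :=
    W.selmerCorank_eq_mordellWeilRank_add_holds p
  omega

/-- **`S → C⁺`**: even the hypothesis-free strengthening (every elliptic `W`, every prime `p`,
no minimality / ordinarity / image condition) follows from the summit. So the five hypotheses of
the crux are not needed for TRUTH (given BSD); they are exactly the hypotheses under which the
known cases `r_an ≤ 3` are theorems (corank-0/1 `p`-converses + `p`-parity). [folklore] -/
theorem lb_everywhere_of_summit (h : _root_.BirchSwinnertonDyer) :
    ∀ (W : WeierstrassCurve ℚ) [W.IsElliptic] (p : ℕ) [Fact p.Prime],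
      W.analyticRank ≤ W.selmerCorank p := by
  intro W _ p _
  have h1 : W.analyticRank = W.mordellWeilRank := h W inferInstance
  have h2 : W.selmerCorank p = W.mordellWeilRank + W.shaCorank p :=
    W.selmerCorank_eq_mordellWeilRank_add_holds p
  omega

/-- Degenerate regime `r_an = 0`: the conclusion holds trivially. [folklore] -/
theorem lb_of_analyticRank_eq_zero (W : WeierstrassCurve ℚ) (p : ℕ) (h0 : W.analyticRank = 0) :
    W.analyticRank ≤ W.selmerCorank p := by
  rw [h0]; exact Nat.zero_le _

end Summit.BirchSwinnertonDyer.BirchSwinnertonDyer.Cruxes.SelmerRankLB.CruxAttack
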